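import Literature.Analysis.Fourier.BoasKacNonnegLattice
import HarnessLib

/-!
# Boas–Kac (Kreĭn) factorisation of a positive definite function of compact support, II: the factor

**Theorem** (`exists_smooth_autocorr_eq_of_fourier_nonneg`; Boas–Kac 1945, Thm 1, for smooth data;
Kreĭn 1940; Akhiezer's factorisation of nonnegative entire functions of exponential type restricted to
this case).  Let `k : ℝ → ℂ` be `C^∞` with `tsupport k ⊆ [-2a, 2a]` (`a > 0`) and suppose that its
Fourier transform is pointwise a nonnegative real, `Re 𝓕 k ξ ≥ 0`, `Im 𝓕 k ξ = 0` for every real `ξ`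
(i.e. `k` is positive definite).  Then `k = f ⋆ f̃` — Mathlib's
`MeasureTheory.convolution f (fun u => conj (f (-u))) (ContinuousLinearMap.mul ℂ ℂ)` — for ONE `C^∞`
function `f` with `tsupport f ⊆ [-a, a]`.  This is the converse of "autocorrelations are positive
definite" for compactly supported smooth functions, with the sharp support `[-a, a]`; it is what makes
the cone of test functions with nonnegative transform on a window coincide with the cone generated by the
hermitian squares `g ⋆ g̃` of half the window (used by the Kreĭn–Bochner representation of the Weil
functional, `Literature/NumberTheory/LFunctions/WeilBochnerRepresentation*.lean`).

Proof.  `BoasKacNonnegLattice.lean` supplies, for every `n`, a polynomial `q_n` (Fejér–Riesz factor of the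
renormalised sample polynomial at mesh `h_n = 4a/(2n+2)`, nonnegative on the circle by Poisson
summation) whose lattice step function `f_n` has `‖f_n‖₂² = Re k(0)`, vanishes off `[0, 2a + h_n)` and
satisfies `‖𝓕 f_n(ξ)‖² → Re 𝓕 k(ξ)`.  Here: a weak cluster point `f°` of `(f_n)` in `L²` (Banach–Alaoglu,
exactly as in the tree's `BoasKac.exists_memLp_norm_sq_fourier_eq_sum`, whose proof is repeated for an
abstract sequence of approximants in `exists_memLp_norm_sq_fourier_eq_of_approx`) vanishes off `[0, 2a]`
and has `‖𝓕 f°‖² = Re 𝓕 k`; since `𝓕 k` is a Schwartz function, `|ξ|ⁿ ‖𝓕 f°(ξ)‖ = |ξ|ⁿ √(Re 𝓕 k ξ)` is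
integrable for all `n` (AM–GM, `integrable_pow_mul_norm_fourier`), so `f°` has a smooth representative
`f₁` (`BoasKac.exists_contDiff_ae_eq_of_fourier_moments`) supported in `[0, 2a]`; `𝓕 (f₁ ⋆ f̃₁) = ‖𝓕 f₁‖²
= 𝓕 k`, Fourier uniqueness and continuity give `f₁ ⋆ f̃₁ = k`, and `f = f₁(· + a)`.

## References

* R. P. Boas, M. Kac, *Inequalities for Fourier transforms of positive functions*, Duke Math. J. 12
  (1945), 189–206, Thm 1. [cite: BoasKac1945, Thm 1]
* M. G. Kreĭn, *Sur le problème du prolongement des fonctions hermitiennes positives et continues*,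
  C. R. (Doklady) Acad. Sci. URSS 26 (1940), 17–22. [cite: Krein1940]
-/

noncomputable section

open Polynomial Filter MeasureTheory Set FourierTransform SchwartzMap
open _root_.Complex _root_.Real
open scoped ComplexConjugate ComplexOrder Topology ContDiff

namespace Literature.Analysis.Fourier.BoasKacNonneg

open Literature.Analysis.Fourier.FejerRiesz Literature.Analysis.Fourier.LatticeStep
  Literature.Analysis.Fourier.BoasKac

/-! ## Weak limits of `L²`-bounded approximants -/

/-- **Weak cluster point of `L²`-bounded approximants** (abstract form of the tree's
`BoasKac.exists_memLp_norm_sq_fourier_eq_sum`, Boas–Kac 1945, proof of Thm 1).  Let `u_N ∈ L²(ℝ)` have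
`∫ |u_N|² ≤ B`, vanish off `[0, L + δ_N)` with `0 < δ_N ≤ L`, `δ_N → 0`, and let `‖𝓕 u_N(ξ)‖² → G(ξ)`
for every `ξ`.  Then some `f ∈ L²(ℝ)` vanishing off `[0, L]` has `‖𝓕 f(ξ)‖² = G(ξ)` for every `ξ`
(Banach–Alaoglu; cluster values of convergent real sequences are their limits).
[cite: BoasKac1945, Thm 1 (proof, limit step)] -/
theorem exists_memLp_norm_sq_fourier_eq_of_approx {L : ℝ} (hL : 0 < L) (u : ℕ → ℝ → ℂ) (δ : ℕ → ℝ)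
    (hδ : Tendsto δ atTop (𝓝 0)) (hδ0 : ∀ N, 0 < δ N) (hδL : ∀ N, δ N ≤ L)
    (hmem : ∀ N, MemLp (u N) 2 volume) {B : ℝ} (hB : ∀ N, ∫ x, ‖u N x‖ ^ 2 ≤ B)
    (hsupp : ∀ N, ∀ x ∉ Ico 0 (L + δ N), u N x = 0) (G : ℝ → ℝ)
    (hG : ∀ ξ, Tendsto (fun N => ‖𝓕 (u N) ξ‖ ^ 2) atTop (𝓝 (G ξ))) :
    ∃ f : ℝ → ℂ, MemLp f 2 volume ∧ (∀ x ∉ Icc 0 L, f x = 0) ∧ ∀ ξ : ℝ, ‖𝓕 f ξ‖ ^ 2 = G ξ := by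
  -- adapted from `BoasKac.exists_memLp_norm_sq_fourier_eq_sum` (tree, `BoasKacFourierSide.lean`)
  set w : ℕ → Lp ℂ 2 (volume : Measure ℝ) := fun N => (hmem N).toLp (u N) with hw
  have hnorm : ∀ N, ‖w N‖ ≤ Real.sqrt B := fun N => norm_toLp_le _ (hB N)
  obtain ⟨fH, hfH⟩ := exists_inner_mapClusterPt_of_bounded hnorm
  set F : ℝ → ℂ := (fH : ℝ → ℂ) with hF
  have hFmem : MemLp F 2 volume := Lp.memLp fH
  have hcluster : ∀ {v : ℝ → ℂ} (hv : MemLp v 2 volume),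
      MapClusterPt (∫ x, v x * conj (F x)) atTop fun N => ∫ x, v x * conj (u N x) := by
    intro v hv
    have h := hfH (hv.toLp v)
    have e1 : inner ℂ fH (hv.toLp v) = ∫ x, v x * conj (F x) := by
      convert inner_toLp_toLp hFmem hv using 2
      exact (Lp.toLp_coeFn fH hFmem).symm
    have e2 : (fun N => inner ℂ (w N) (hv.toLp v)) = fun N => ∫ x, v x * conj (u N x) := by
      funext N; exact inner_toLp_toLp _ hv
    rwa [e1, e2] at h
  -- (1) `F` vanishes a.e. on every set eventually avoided by the approximants
  have hvanish : ∀ {S : Set ℝ}, MeasurableSet S → (∀ᶠ N in atTop, ∀ x ∈ S, u N x = 0) →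
      ∀ᵐ x, x ∈ S → F x = 0 := by
    intro S hS hev
    have hv : MemLp (S.indicator F) 2 volume := hFmem.indicator hS
    have hzero : ∀ᶠ N in atTop, (∫ x, S.indicator F x * conj (u N x)) = 0 := by
      filter_upwards [hev] with N hN
      refine integral_eq_zero_of_ae (Eventually.of_forall fun x => ?_)
      by_cases hx : x ∈ S
      · simp only [Pi.zero_apply]; rw [hN x hx, map_zero, mul_zero]
      · simp only [Pi.zero_apply]; rw [indicator_of_notMem hx, zero_mul]
    have hlim := eq_of_mapClusterPt_of_eventuallyEq (hcluster hv) hzero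
    have hint : ∫ x, S.indicator F x * conj (F x) = ((∫ x, S.indicator (fun x => ‖F x‖ ^ 2) x : ℝ) : ℂ) := by
      rw [← integral_complex_ofReal]
      refine integral_congr_ae (Eventually.of_forall fun x => ?_)
      beta_reduce
      by_cases hx : x ∈ S
      · rw [indicator_of_mem hx, indicator_of_mem hx, mul_conj, normSq_eq_norm_sq]
      · rw [indicator_of_notMem hx, indicator_of_notMem hx, zero_mul, Complex.ofReal_zero]
    rw [hint] at hlim
    have hlim' : ∫ x, S.indicator (fun x => ‖F x‖ ^ 2) x = 0 := by exact_mod_cast hlim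
    have hnn : 0 ≤ fun x => S.indicator (fun x => ‖F x‖ ^ 2) x :=
      fun x => indicator_nonneg (fun _ _ => by positivity) _
    have hintg : Integrable (fun x => S.indicator (fun x => ‖F x‖ ^ 2) x) :=
      ((memLp_two_iff_integrable_sq_norm hFmem.1).mp hFmem).indicator hS
    filter_upwards [(integral_eq_zero_iff_of_nonneg hnn hintg).mp hlim'] with x hx hxS
    have h2 : ‖F x‖ ^ 2 = 0 := by simpa [indicator_of_mem hxS] using hx
    exact norm_eq_zero.mp (pow_eq_zero_iff two_ne_zero |>.mp h2)
  have hneg : ∀ᵐ x, x ∈ Iio (0 : ℝ) → F x = 0 :=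
    hvanish measurableSet_Iio (Eventually.of_forall fun N x hx =>
      hsupp N x fun h' => not_le.mpr (mem_Iio.mp hx) h'.1)
  have hδ_ev : ∀ ε : ℝ, 0 < ε → ∀ᶠ N in atTop, δ N < ε := fun ε hε => by
    obtain ⟨N₀, hN₀⟩ := (Metric.tendsto_atTop.mp hδ) ε hε
    refine eventually_atTop.mpr ⟨N₀, fun N hN => ?_⟩
    have := hN₀ N hN
    rwa [dist_zero_right, Real.norm_eq_abs, abs_of_pos (hδ0 N)] at this
  have hpos : ∀ m : ℕ, ∀ᵐ x, x ∈ Ioi (L + 1 / ((m : ℝ) + 1)) → F x = 0 := fun m => by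
    refine hvanish measurableSet_Ioi ?_
    filter_upwards [hδ_ev (1 / ((m : ℝ) + 1)) (by positivity)] with N hN x hx
    exact hsupp N x fun h' => by linarith [h'.2, mem_Ioi.mp hx]
  -- the representative `f = 𝟙_{[0,L]} F`
  set f : ℝ → ℂ := (Icc 0 L).indicator F with hf
  have hFf : ∀ᵐ x, F x = f x := by
    rw [← ae_all_iff] at hpos
    filter_upwards [hneg, hpos] with x hxneg hxpos
    by_cases hxI : x ∈ Icc 0 L
    · rw [hf, indicator_of_mem hxI]
    · rw [hf, indicator_of_notMem hxI]
      rcases lt_or_ge x 0 with h0 | h0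
      · exact hxneg h0
      · have hxL : L < x := not_le.mp fun h' => hxI ⟨h0, h'⟩
        obtain ⟨m, hm⟩ := exists_nat_one_div_lt (sub_pos.mpr hxL)
        exact hxpos m (by rw [mem_Ioi]; linarith)
  have hfmem : MemLp f 2 volume := MemLp.ae_eq hFf hFmem
  refine ⟨f, hfmem, fun x hx => indicator_of_notMem hx _, fun ξ => ?_⟩
  -- (2) the Fourier identity at `ξ`: test against `e = 𝟙_{[0,2L]} · conj (𝐞(-xξ))`
  set e : ℝ → ℂ := (Icc 0 (2 * L)).indicator (fun x => conj ((𝐞 (-(x * ξ)) : ℂ))) with he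
  have hemem : MemLp e 2 volume :=
    memLp_two_indicator_Icc (by fun_prop) (C := 1) (fun x => by rw [norm_conj, Circle.norm_coe]) 0 (2 * L)
  have hcl := hcluster hemem
  have happ : (fun N => ∫ x, e x * conj (u N x)) = fun N => conj (𝓕 (u N) ξ) := by
    funext N
    rw [Real.fourier_real_eq, ← integral_conj]
    refine integral_congr_ae (Eventually.of_forall fun x => ?_)
    beta_reduce
    by_cases hx : x ∈ Icc 0 (2 * L)
    · rw [he, indicator_of_mem hx, Circle.smul_def, smul_eq_mul, map_mul]
    · rw [hsupp N x fun h' => hx ⟨h'.1, by linarith [h'.2, hδL N]⟩, map_zero, mul_zero,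
        smul_zero, map_zero]
  have hlimside : ∫ x, e x * conj (F x) = conj (𝓕 f ξ) := by
    rw [Real.fourier_real_eq, ← integral_conj]
    refine integral_congr_ae ?_
    filter_upwards [hFf] with x hx
    rw [hx]
    by_cases hxI : x ∈ Icc 0 (2 * L)
    · rw [he, indicator_of_mem hxI, Circle.smul_def, smul_eq_mul, map_mul]
    · have hxI' : x ∉ Icc 0 L := fun h' => hxI ⟨h'.1, by linarith [h'.2]⟩
      rw [he, indicator_of_notMem hxI, zero_mul, hf, indicator_of_notMem hxI', smul_zero, map_zero]
  rw [happ, hlimside] at hcl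
  have hcl2 := mapClusterPt_comp hcl continuous_normSq
  have hseq : (normSq ∘ fun N => conj (𝓕 (u N) ξ)) = fun N => ‖𝓕 (u N) ξ‖ ^ 2 := by
    funext N; simp [normSq_eq_norm_sq]
  rw [hseq, normSq_conj, normSq_eq_norm_sq] at hcl2
  exact eq_of_mapClusterPt_of_tendsto hcl2 (hG ξ)

/-! ## Fourier moments of the `L²` factor -/

/-- AM–GM in the form `|ξ|ᵐ y ≤ (|ξ|^{2m} (1+ξ²) y² + (1+ξ²)⁻¹)/2` (`y ≥ 0`). [folklore] -/
theorem pow_mul_le_of_sq (ξ : ℝ) (m : ℕ) (y : ℝ) :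
    |ξ| ^ m * y ≤ (|ξ| ^ (2 * m) * (1 + ξ ^ 2) * y ^ 2 + (1 + ξ ^ 2)⁻¹) / 2 := by
  have hq : 0 < 1 + ξ ^ 2 := by positivity
  have e : |ξ| ^ (2 * m) = (|ξ| ^ m) ^ 2 := by rw [pow_mul']
  have key : (|ξ| ^ m) ^ 2 * (1 + ξ ^ 2) * y ^ 2 + (1 + ξ ^ 2)⁻¹ - 2 * (|ξ| ^ m * y) =
      (|ξ| ^ m * y * (1 + ξ ^ 2) - 1) ^ 2 / (1 + ξ ^ 2) := by
    field_simp
    ring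
  have hnn : 0 ≤ (|ξ| ^ m * y * (1 + ξ ^ 2) - 1) ^ 2 / (1 + ξ ^ 2) := by positivity
  rw [e]
  linarith

/-- **Fourier moments of the `L²` factor.**  If `f ∈ L¹` has `‖𝓕 f ξ‖² = Re 𝓕 k ξ` for a `C^∞`
compactly supported `k` (so that `𝓕 k` is a Schwartz function), then `ξ ↦ |ξ|ᵐ ‖𝓕 f ξ‖` is integrable
for every `m` (`|ξ|ᵐ √(Re 𝓕 k) ≤ (|ξ|^{2m}(1+ξ²)|𝓕 k| + (1+ξ²)⁻¹)/2`). [folklore] -/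
theorem integrable_pow_mul_norm_fourier {f k : ℝ → ℂ} (hf : Integrable f) (hk : ContDiff ℝ ∞ k)
    (hkc : HasCompactSupport k) (hfk : ∀ ξ, ‖𝓕 f ξ‖ ^ 2 = (𝓕 k ξ).re) (m : ℕ) :
    Integrable (fun ξ : ℝ => ‖ξ‖ ^ m * ‖𝓕 f ξ‖) := by
  have hFcont : Continuous (𝓕 f) :=
    VectorFourier.fourierIntegral_continuous Real.continuous_fourierChar (by exact continuous_inner) hf
  have hcoe : ((hkc.toSchwartzMap hk : 𝓢(ℝ, ℂ)) : ℝ → ℂ) = k := rfl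
  have hK : ∀ j : ℕ, Integrable (fun ξ : ℝ => ‖ξ‖ ^ j * ‖𝓕 k ξ‖) := fun j => by
    have := (𝓕 (hkc.toSchwartzMap hk)).integrable_pow_mul volume j
    rw [fourier_coe, hcoe] at this
    exact this
  have hmaj : Integrable
      (fun ξ : ℝ => (‖ξ‖ ^ (2 * m) * (1 + ξ ^ 2) * ‖𝓕 k ξ‖ + (1 + ξ ^ 2)⁻¹) / 2) := by
    refine (Integrable.add ?_ integrable_inv_one_add_sq).div_const 2
    have e : (fun ξ : ℝ => ‖ξ‖ ^ (2 * m) * (1 + ξ ^ 2) * ‖𝓕 k ξ‖) =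
        fun ξ => ‖ξ‖ ^ (2 * m) * ‖𝓕 k ξ‖ + ‖ξ‖ ^ (2 * m + 2) * ‖𝓕 k ξ‖ := by
      funext ξ
      rw [Real.norm_eq_abs, ← sq_abs ξ]
      ring
    rw [e]
    exact (hK _).add (hK _)
  refine hmaj.mono' ((continuous_norm.pow m).mul hFcont.norm).aestronglyMeasurable
    (Eventually.of_forall fun ξ => ?_)
  rw [Real.norm_eq_abs, abs_of_nonneg (by positivity), Real.norm_eq_abs]
  have hre : (𝓕 k ξ).re ≤ ‖𝓕 k ξ‖ := Complex.re_le_norm _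
  have h1 := pow_mul_le_of_sq ξ m ‖𝓕 f ξ‖
  rw [hfk ξ] at h1
  calc |ξ| ^ m * ‖𝓕 f ξ‖ ≤ (|ξ| ^ (2 * m) * (1 + ξ ^ 2) * (𝓕 k ξ).re + (1 + ξ ^ 2)⁻¹) / 2 := h1
    _ ≤ (|ξ| ^ (2 * m) * (1 + ξ ^ 2) * ‖𝓕 k ξ‖ + (1 + ξ ^ 2)⁻¹) / 2 := by gcongr

/-! ## The theorem -/

/-- **Boas–Kac / Kreĭn factorisation of a smooth positive definite function of compact support.**
Let `k : ℝ → ℂ` be `C^∞` with `tsupport k ⊆ [-2a, 2a]`, `a > 0`, and `Re 𝓕 k ξ ≥ 0`, `Im 𝓕 k ξ = 0` for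
all real `ξ`.  Then there is a `C^∞` function `f` of compact support, `tsupport f ⊆ [-a, a]`, with
`f ⋆ f̃ = k`, i.e. `MeasureTheory.convolution f (fun u => conj (f (-u))) (ContinuousLinearMap.mul ℂ ℂ) = k`
(Boas–Kac 1945, Thm 1, with the smooth upgrade; Kreĭn 1940). [cite: BoasKac1945, Thm 1] -/
theorem exists_smooth_autocorr_eq_of_fourier_nonneg {a : ℝ} (ha : 0 < a) {k : ℝ → ℂ}
    (hk : ContDiff ℝ ∞ k) (hka : tsupport k ⊆ Icc (-(2 * a)) (2 * a))
    (hpos : ∀ ξ : ℝ, 0 ≤ (𝓕 k ξ).re ∧ (𝓕 k ξ).im = 0) :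
    ∃ f : ℝ → ℂ, ContDiff ℝ ∞ f ∧ HasCompactSupport f ∧ tsupport f ⊆ Icc (-a) a ∧
      MeasureTheory.convolution f (fun u => (starRingEnd ℂ) (f (-u))) (ContinuousLinearMap.mul ℂ ℂ)
        volume = k := by
  -- Step 0: bookkeeping on `k`
  have hkc : HasCompactSupport k :=
    IsCompact.of_isClosed_subset isCompact_Icc (isClosed_tsupport _) hka
  have hkcont : Continuous k := hk.continuous
  have hkint : Integrable k := hkcont.integrable_of_hasCompactSupport hkc
  have hka' : ∀ x, 2 * a < |x| → k x = 0 := fun x hx =>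
    image_eq_zero_of_notMem_tsupport fun h' => by
      have := hka h'
      rw [mem_Icc, ← abs_le] at this
      linarith
  have hpos' : ∀ ξ, 0 ≤ 𝓕 k ξ := fun ξ => Complex.nonneg_iff.2 ⟨(hpos ξ).1, (hpos ξ).2.symm⟩
  have h4 : 0 < 4 * a := by positivity
  -- Step 1: the Fejér–Riesz factors of the renormalised sample polynomials
  have hfac := fun n : ℕ =>
    exists_factor (k := k) (mesh_pos h4 (2 * n + 1)) hk hkc hka' hpos' n (succ_mul_mesh a n)
  choose q hq hPq using hfac
  -- Step 2: the weak limit of the lattice step functions `latticeStep h_n q_n`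
  have hδL : ∀ n : ℕ, mesh (4 * a) (2 * n + 1) ≤ 2 * a := fun n => by
    rw [mesh_four_mul]
    exact div_le_self (by positivity) (by linarith [(Nat.cast_nonneg n : (0 : ℝ) ≤ n)])
  obtain ⟨f0, hmem, hsupp0, hfour⟩ := exists_memLp_norm_sq_fourier_eq_of_approx (L := 2 * a)
    (by positivity) (fun n => latticeStep (mesh (4 * a) (2 * n + 1)) (q n))
    (fun n => mesh (4 * a) (2 * n + 1)) (tendsto_mesh_four_mul a) (fun n => mesh_pos h4 _) hδL
    (fun n => memLp_two_latticeStep (mesh_pos h4 _) (hq n)) (B := (k 0).re)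
    (fun n => (integral_norm_sq_latticeStep_factor (mesh_pos h4 _) n (succ_mul_mesh a n) (hq n)
      (hPq n)).le)
    (fun n x hx => latticeStep_factor_eq_zero (mesh_pos h4 _) n (succ_mul_mesh a n) (hq n) hx)
    (fun ξ => (𝓕 k ξ).re)
    (fun ξ => tendsto_norm_sq_fourier_latticeStep_factor ha hkcont hka' q hq hPq ξ)
  -- Step 3: the smooth representative and its support
  have hf0int : Integrable f0 := memLp_one_iff_integrable.mp
    (hmem.mono_exponent_of_measure_support_ne_top (s := Icc 0 (2 * a)) hsupp0 measure_Icc_lt_top.ne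
      (by norm_num))
  obtain ⟨f₁, hf₁smooth, hf₁ae⟩ := exists_contDiff_ae_eq_of_fourier_moments hf0int
    (integrable_pow_mul_norm_fourier hf0int hk hkc hfour)
  have hf₁supp : tsupport f₁ ⊆ Icc 0 (2 * a) :=
    tsupport_subset_of_ae_eq hf₁smooth.continuous hf₁ae isClosed_Icc hsupp0
  have hf₁cs : HasCompactSupport f₁ :=
    IsCompact.of_isClosed_subset isCompact_Icc (isClosed_tsupport _) hf₁supp
  have hf₁int : Integrable f₁ := hf₁smooth.continuous.integrable_of_hasCompactSupport hf₁cs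
  -- Step 4: `f₁ ⋆ f̃₁ = k` by Fourier uniqueness and continuity
  have hfour₁ : ∀ ξ, 𝓕 (MeasureTheory.convolution f₁ (fun u => (starRingEnd ℂ) (f₁ (-u))) (ContinuousLinearMap.mul ℂ ℂ) volume) ξ = 𝓕 k ξ := by
    intro ξ
    rw [fourier_autocorr hf₁int, BoasKac.fourier_congr_ae hf₁ae, hfour ξ]
    exact Complex.ext (by simp) (by simp [(hpos ξ).2])
  have hae : MeasureTheory.convolution f₁ (fun u => (starRingEnd ℂ) (f₁ (-u))) (ContinuousLinearMap.mul ℂ ℂ) volume =ᵐ[volume] k :=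
    Literature.Analysis.Fourier.ae_eq_of_fourier_eq (integrable_autocorr hf₁int) hkint (funext hfour₁)
  have heq : MeasureTheory.convolution f₁ (fun u => (starRingEnd ℂ) (f₁ (-u))) (ContinuousLinearMap.mul ℂ ℂ) volume = k :=
    (Continuous.ae_eq_iff_eq volume (continuous_autocorr hf₁smooth.continuous hf₁cs) hkcont).mp hae
  -- Step 5: translate back to `[-a, a]`
  refine ⟨fun x => f₁ (x - (-a)), hf₁smooth.comp (contDiff_id.sub contDiff_const),
    hf₁cs.comp_homeomorph (Homeomorph.subRight (-a)), ?_, ?_⟩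
  · refine closure_minimal (fun x hx => ?_) isClosed_Icc
    have hx' : x - (-a) ∈ tsupport f₁ := subset_tsupport _ hx
    have := hf₁supp hx'
    exact ⟨by linarith [this.1], by linarith [this.2]⟩
  · rw [autocorr_comp_sub f₁ (-a), heq]

end Literature.Analysis.Fourier.BoasKacNonneg

end
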